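import Summits.QuantumFields.YangMills.Theorems.BalabanUVNodesN19UniformMomentPriceTwoSided
import Summits.QuantumFields.YangMills.Theorems.BalabanUVNodesN19StringFieldLawRate

/-!
# YM-DAG node N19 (= NE7 proper) — THE `m⁻¹` ROAD AT THE SCHEME: continuum joint laws at `≍ |ι|²∕log R_K⁻¹`, the string-field law at `≍ (log L_K)²∕L_K`

Cell `pub-ymgap`, HUMAN RULING D-0062 (Track A), R141 (C) wider-strategy seat `pub-ymgap-dag-n19-e` (strategy s3 = ALTERNATIVE CURRENCY), generation
g20, module 4 (lineage module 62).  Route `Summits/QuantumFields/YangMills/Theses/BalabanUVNodes.lean` rev 25, cluster item K3⁷ «SpineGivenEndpointR13SepCoPH»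
(stmt-QuantumFields-20544, dag-lead WORDS-143); filed `--supports` that item `--as helper` (it proves no registered stub).  COUNT-NEUTRAL: bookkeeping over
the sibling module 61 `…N19DiscreteJacksonPricing` (`abs_integral_sub_integral_le_of_mixedMoments_jackson`), p570436 `…N19JointLawRate`
(`abs_mixedMoment_sub_integral_le_of_uniformTarget` — p482030's string-independent expectation rate on the concatenated string) and p572113
`…N19StringFieldLawRate` (`abs_sub_truncate_le`, `abs_sub_cylinder_le`), module 63 `…N19UniformMomentPriceTwoSided` (`law_price_le_of_uniformMoments`),
p558060 (`prodObs_replicate_flatten`) and p482030 (`abs_expectAt_sub_lim_le_linlog_tail_of_target`) BY NAME; `Spine.NE7.Target` (N19's DECL-target shape,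
NOT PRINTED, NOT proved)
and the law hypotheses are HYPOTHESES; no Theses import; NOT a discharge claim.

THE RESULT.  Under N19's DECL-target shape for EVERY string with COMMON data (`∀ os, Spine.NE7.Target vol l₀ δ (schemeZ S os)`, `0 < l₀`) every mixed
moment of a finite family of strings is within `R_K = (4e^{1+l₀}∕l₀)·τ_K·(1 + log⁺ τ_K⁻¹)`, `τ_K = Σ_j 2·vol·δ_{K+j}`, of its continuum value (p570436),
UNIFORMLY IN THE DEGREE.  Module 61's discrete tensor Jackson quasi-interpolant turns this uniform moment closeness into
  ★★ `abs_integral_sub_jointLaw_le_of_uniformTarget_jackson`: for the continuum joint law `ν` of `(∏os_i)_{i∈ι}` and every continuous `f` with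
  `|f u − f v| ≤ K_f Σ_i|u_i − v_i|`, `|f| ≤ G_f` on the cube, every `m ≥ 1` and every step `K`,
  `|∫ f((∏os_i)_i) dgibbs_K − ∫ f dν| ≤ 2πK_f|ι|∕m + G_f·(m·9^m)^{|ι|}·R_K`
(p570436 had `2K_f|ι|∕√n + G_f·2^{n|ι|}·R_K`).  With `m ≍ log R_K⁻¹∕(2|ι| log 9)` the bounded-Lipschitz distance of the step-`K` joint law to `ν` is
`≲ K_f|ι|²∕log R_K⁻¹ + G_f·(log R_K⁻¹)^{|ι|}·√R_K` (absolute constants dropped) — order `|ι|²∕K` for geometric remainders (`log R_K⁻¹ ≍ K`), against p570436's `|ι|^{3∕2}∕√K`; for ONE string this is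
`1∕K` against p556871's `log K∕K` (the window-cgf currency; uniform `Target` buys the uniform-in-degree moment rate, which the window alone does not give).
The uniform form (∀ η ∃ K₀ ∀ f in the BL unit ball) is p570436's `jointLaw_boundedLipschitz_of_uniformTarget` (same statement; not re-derived here);
★ `abs_integral_cylinder_sub_le_of_uniformTarget_jackson` treats the cylinder functionals of a string-field law `Λ`; and ★★ `abs_integral_stringField_sub_le_of_uniformTarget_jackson` the WHOLE STRING-FIELD LAW in the product metric
`d_e(x,y) = Σ_j 2^{−(j+1)}|x_{e_j} − y_{e_j}|`: `|∫ F dlaw_K − ∫ F dΛ| ≤ 2K_F·2^{−M} + 2πK_F·M∕m + G_F·(m·9^m)^M·R_K` for every truncation level `M` and every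
`m ≥ 1` (p572113 had `2K_F·M∕√n + G_F·2^{nM}·R_K`; the optimised order improves from `(log L)^{3∕2}∕√L` to `(log L)²∕L`, `L = log R_K⁻¹`).  §3 ONE STRING,
CLOSED FORM (the sibling module 63's `law_price_le_of_uniformMoments` — the `d = 1` price `Θ(1∕log r⁻¹)` of uniform moment closeness, two-sided there — at
`r = R_K ≤ 1`): ★★ `abs_integral_sub_continuumLaw_le_inv_log_of_uniformTarget`: `|∫ g(∏os) dgibbs_K − ∫ g dν_os| ≤ 48(K_g + G_g)∕(1 + log R_K⁻¹)` for g9's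
continuum law `ν_os` of ONE string — `≍ 1∕K` for geometric remainders, where p556871 (window of that string only) had `log(e+L_K)∕(1+L_K) ≍ log K∕K`.

HONEST FRAMING (binding).  [folklore] ∕ bookkeeping; `ν`, `Λ` are typed RESTATEMENT DEVICES for the string-indexed limits (dag-lead guard); NO consumer in
the DAG today; `Target` HYPOTHESIS; rates NOT claimed optimal in the constants; nothing of Bałaban's instantiated; NE7 NOT PRINTED, NOT proved; N19 NOT
discharged; count-neutral.  One finite `T⁴` programme at fixed `ε` → 0 at FIXED volume; NOT a continuum ∕ `ℝ⁴` ∕ infinite-volume ∕ OS ∕ mass-gap ∕ Clay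
statement.  0 `def` ∕ 0 `sorry`.
-/

noncomputable section

open Real Finset Filter Topology MeasureTheory ProbabilityTheory

namespace Summit.QuantumFields.YangMills.Theorems.BalabanUVNodesN19JointLawSharpRate

open Literature.MathematicalPhysics.QuantumFieldTheory.Balaban1983to89
open T4GenFunBounds (prodObs gibbsMeasure schemeZ)
open Missing (TorusScheme)
open Summit.QuantumFields.BalabanUV.T4Continuum.Spine
open Summit.QuantumFields.YangMills.BalabanUVNodes.N19ExpectationCurrencyAtScheme (mul_nonneg_of_matchingModConstants)
open Summit.QuantumFields.YangMills.Theorems.BalabanUVNodesN19DiscreteJacksonPricing (abs_integral_sub_integral_le_of_mixedMoments_jackson)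
open Summit.QuantumFields.YangMills.Theorems.BalabanUVNodesN19JointLawRate (abs_mixedMoment_sub_integral_le_of_uniformTarget)
open Summit.QuantumFields.YangMills.Theorems.BalabanUVNodesN19StringFieldLawRate (abs_sub_truncate_le abs_sub_cylinder_le)
open Summit.QuantumFields.YangMills.Theorems.BalabanUVNodesN19ContinuumJointLaws (prodObs_replicate_flatten)
open Summit.QuantumFields.YangMills.BalabanUVNodes.N19ExpectationCurrencyTwoConstantsRate (abs_expectAt_sub_lim_le_linlog_tail_of_target)
open Summit.QuantumFields.YangMills.Theorems.BalabanUVNodesN19UniformMomentPriceTwoSided (law_price_le_of_uniformMoments)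
open T4GenFunBounds (expectAt_eq_integral_gibbs)

variable {G : Type*} [GaugeGroup G] [MeasurableSpace G] [RegularGaugeGroup G] [HaarData G] {O : Type*}
  (S : TorusScheme G O) (hβ : ∀ K, 0 ≤ S.β K) (hm : ∀ K o, Measurable (S.obs K o))
  (h1 : ∀ K o U, |S.obs K o U| ≤ 1)

include hβ hm h1

/-! ## §1 The continuum joint laws on the `m⁻¹` road -/

/-- **★★ THE CONTINUUM JOINT LAWS AT RATE `2πK|ι|∕m + G·(m·9^m)^{|ι|}·R_K`** [folklore + bookkeeping].  Torus scheme with `β_K ≥ 0` and measurable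
observables bounded by `1`; N19's DECL-target shape for EVERY string with common data (`∀ os, Spine.NE7.Target vol l₀ δ (schemeZ S os)`, `0 < l₀` —
HYPOTHESIS); `ν` a probability law on `ℝ^ι` carried by `[−1,1]^ι` receiving the limits of all continuous functionals of the finite family `(∏os_i)_{i∈ι}`
(p558060's continuum joint law).  Then for every continuous `f` with `|f u − f v| ≤ K_f Σ_i|u_i − v_i|` and `|f| ≤ G_f` on the cube, every `m ≥ 1` and
every step `K`: `|∫ f((∏os_i)_i) dgibbs_K − ∫ f dν| ≤ 2K_f·π|ι|∕m + G_f·(m·9^m)^{|ι|}·(4e^{1+l₀}∕l₀)·τ_K·(1 + log⁺ τ_K⁻¹)`. -/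
theorem abs_integral_sub_jointLaw_le_of_uniformTarget_jackson {ι : Type*} [Fintype ι] [DecidableEq ι] {vol l₀ : ℝ} {δ : ℕ → ℝ}
    (hl₀ : 0 < l₀) (hT : ∀ os : List O, NE7.Target vol l₀ δ (schemeZ S os)) (os : ι → List O) (ν : Measure (ι → ℝ)) [IsProbabilityMeasure ν]
    (hν1 : ν (Set.pi Set.univ (fun _ : ι => Set.Icc (-1 : ℝ) 1))ᶜ = 0)
    (hν : ∀ f : (ι → ℝ) → ℝ, Continuous f →
      Tendsto (fun K => ∫ U, f (fun i => prodObs S K (os i) U) ∂gibbsMeasure (S.P K) (S.β K)) atTop (𝓝 (∫ x, f x ∂ν)))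
    {f : (ι → ℝ) → ℝ} (hf : Continuous f) {Kf Gf : ℝ} (hK0 : 0 ≤ Kf)
    (hK : ∀ u v : ι → ℝ, (∀ i, u i ∈ Set.Icc (-1 : ℝ) 1) → (∀ i, v i ∈ Set.Icc (-1 : ℝ) 1) → |f u - f v| ≤ Kf * ∑ i, |u i - v i|)
    (hG : ∀ u : ι → ℝ, (∀ i, u i ∈ Set.Icc (-1 : ℝ) 1) → |f u| ≤ Gf) {m : ℕ} (hm0 : 0 < m) (K : ℕ) :
    |∫ U, f (fun i => prodObs S K (os i) U) ∂gibbsMeasure (S.P K) (S.β K) - ∫ x, f x ∂ν| ≤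
      2 * Kf * (π * Fintype.card ι / m) + Gf * (m * 9 ^ m) ^ Fintype.card ι *
        (4 * Real.exp (1 + l₀) / l₀ * (∑' j, 2 * (vol * δ (K + j))) * (1 + Real.posLog (∑' j, 2 * (vol * δ (K + j)))⁻¹)) := by
  haveI hP : IsProbabilityMeasure (gibbsMeasure (G := G) (S.P K) (S.β K)) := T4GenFunBounds.isProbabilityMeasure_gibbsMeasure (G := G) (S.P K) (hβ K)
  -- the step-`K` joint law as a law on `ℝ^ι`
  have hvec : Measurable fun U : GaugeField (S.P K) 0 G => fun i => prodObs S K (os i) U :=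
    measurable_pi_lambda _ fun i => T4GenFunBounds.measurable_prodObs S hm K (os i)
  set P : Measure (ι → ℝ) := (gibbsMeasure (S.P K) (S.β K)).map fun U => fun i => prodObs S K (os i) U with hPdef
  haveI : IsProbabilityMeasure P := Measure.isProbabilityMeasure_map hvec.aemeasurable
  have hPc : P (Set.pi Set.univ (fun _ : ι => Set.Icc (-1 : ℝ) 1))ᶜ = 0 := by
    rw [hPdef, Measure.map_apply hvec (MeasurableSet.univ_pi fun _ => measurableSet_Icc).compl]
    have he : (fun U : GaugeField (S.P K) 0 G => fun i => prodObs S K (os i) U) ⁻¹' (Set.pi Set.univ (fun _ : ι => Set.Icc (-1 : ℝ) 1))ᶜ = ∅ := by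
      ext U
      simp only [Set.mem_preimage, Set.mem_compl_iff, Set.mem_empty_iff_false, iff_false, not_not, Set.mem_univ_pi]
      exact fun i => abs_le.1 (T4GenFunBounds.abs_prodObs_le_one S h1 K (os i) _)
    rw [he, measure_empty]
  have hint : ∀ {h : (ι → ℝ) → ℝ}, Continuous h → ∫ x, h x ∂P = ∫ U, h (fun i => prodObs S K (os i) U) ∂gibbsMeasure (S.P K) (S.β K) :=
    fun hh => integral_map hvec.aemeasurable hh.aestronglyMeasurable
  -- nonnegativity of the rate
  have hτ0 : 0 ≤ ∑' j, 2 * (vol * δ (K + j)) := tsum_nonneg fun j => mul_nonneg two_pos.le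
    (mul_nonneg_of_matchingModConstants hl₀.le (hT []).1 (K + j))
  have hR0 : 0 ≤ 4 * Real.exp (1 + l₀) / l₀ * (∑' j, 2 * (vol * δ (K + j))) * (1 + Real.posLog (∑' j, 2 * (vol * δ (K + j)))⁻¹) :=
    mul_nonneg (mul_nonneg (div_nonneg (mul_nonneg (by norm_num) (Real.exp_pos _).le) hl₀.le) hτ0)
      (add_nonneg zero_le_one Real.posLog_nonneg)
  -- mixed moments up to degree `2m` (indeed all) are `R_K`-close
  have hmom : ∀ jj : ι → Fin (2 * m + 1), |∫ x, ∏ i, x i ^ (jj i : ℕ) ∂P - ∫ x, ∏ i, x i ^ (jj i : ℕ) ∂ν| ≤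
      4 * Real.exp (1 + l₀) / l₀ * (∑' j, 2 * (vol * δ (K + j))) * (1 + Real.posLog (∑' j, 2 * (vol * δ (K + j)))⁻¹) := fun jj => by
    rw [hint (h := fun x : ι → ℝ => ∏ i, x i ^ (jj i : ℕ)) (continuous_finsetProd _ fun i _ => (continuous_apply i).pow _)]
    exact abs_mixedMoment_sub_integral_le_of_uniformTarget S hβ hm h1 hl₀ hT os ν hν (fun i => (jj i : ℕ)) K
  rw [← hint hf]
  exact abs_integral_sub_integral_le_of_mixedMoments_jackson hPc hν1 hm0 hR0 hmom hf hK0 hK hG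

/-- **★ THE CYLINDER FUNCTIONALS OF A STRING-FIELD LAW, `m⁻¹` ROAD** [bookkeeping]: under uniform `Target` (`0 < l₀`), if a probability law `Λ` on `ℝ^{List O}`
carried by the cube receives the limits of all continuous functionals of the string field (`[Countable O]`), then for every finite family `os : ι → List O`,
every admissible `f`, every `m ≥ 1` and `K`: `|∫ f((∏os_i)_i) dgibbs_K − ∫ f(x ∘ os) dΛ(x)| ≤ 2πK_f|ι|∕m + G_f·(m·9^m)^{|ι|}·R_K`. -/
theorem abs_integral_cylinder_sub_le_of_uniformTarget_jackson [Countable O] {ι : Type*} [Fintype ι] [DecidableEq ι] {vol l₀ : ℝ} {δ : ℕ → ℝ}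
    (hl₀ : 0 < l₀) (hT : ∀ os : List O, NE7.Target vol l₀ δ (schemeZ S os)) (os : ι → List O) (Λ : Measure (List O → ℝ)) [IsProbabilityMeasure Λ]
    (hΛ1 : Λ (Set.pi Set.univ (fun _ : List O => Set.Icc (-1 : ℝ) 1))ᶜ = 0)
    (hΛ : ∀ F : (List O → ℝ) → ℝ, Continuous F →
      Tendsto (fun K => ∫ U, F (fun os' => prodObs S K os' U) ∂gibbsMeasure (S.P K) (S.β K)) atTop (𝓝 (∫ x, F x ∂Λ)))
    {f : (ι → ℝ) → ℝ} (hf : Continuous f) {Kf Gf : ℝ} (hK0 : 0 ≤ Kf)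
    (hK : ∀ u v : ι → ℝ, (∀ i, u i ∈ Set.Icc (-1 : ℝ) 1) → (∀ i, v i ∈ Set.Icc (-1 : ℝ) 1) → |f u - f v| ≤ Kf * ∑ i, |u i - v i|)
    (hG : ∀ u : ι → ℝ, (∀ i, u i ∈ Set.Icc (-1 : ℝ) 1) → |f u| ≤ Gf) {m : ℕ} (hm0 : 0 < m) (K : ℕ) :
    |∫ U, f (fun i => prodObs S K (os i) U) ∂gibbsMeasure (S.P K) (S.β K) - ∫ x, f (fun i => x (os i)) ∂Λ| ≤
      2 * Kf * (π * Fintype.card ι / m) + Gf * (m * 9 ^ m) ^ Fintype.card ι *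
        (4 * Real.exp (1 + l₀) / l₀ * (∑' j, 2 * (vol * δ (K + j))) * (1 + Real.posLog (∑' j, 2 * (vol * δ (K + j)))⁻¹)) := by
  have hr : Continuous fun x : List O → ℝ => fun i => x (os i) := continuous_pi fun i => continuous_apply (os i)
  haveI : IsProbabilityMeasure (Λ.map fun x : List O → ℝ => fun i => x (os i)) := Measure.isProbabilityMeasure_map hr.measurable.aemeasurable
  have hc : (Λ.map fun x : List O → ℝ => fun i => x (os i)) (Set.pi Set.univ (fun _ : ι => Set.Icc (-1 : ℝ) 1))ᶜ = 0 := by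
    rw [Measure.map_apply hr.measurable (MeasurableSet.univ_pi fun _ => measurableSet_Icc).compl]
    refine measure_mono_null (fun x hx => ?_) hΛ1
    simp only [Set.mem_preimage, Set.mem_compl_iff, Set.mem_univ_pi] at hx ⊢
    exact fun h => hx fun i => h (os i)
  have hlim : ∀ g : (ι → ℝ) → ℝ, Continuous g →
      Tendsto (fun K => ∫ U, g (fun i => prodObs S K (os i) U) ∂gibbsMeasure (S.P K) (S.β K)) atTop
        (𝓝 (∫ y, g y ∂(Λ.map fun x : List O → ℝ => fun i => x (os i)))) := fun g hg => by
    rw [integral_map hr.measurable.aemeasurable hg.aestronglyMeasurable]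
    exact hΛ (fun x => g (fun i => x (os i))) (hg.comp hr)
  rw [← integral_map hr.measurable.aemeasurable hf.aestronglyMeasurable]
  exact abs_integral_sub_jointLaw_le_of_uniformTarget_jackson S hβ hm h1 hl₀ hT os _ hc hlim hf hK0 hK hG hm0 K

/-! ## §2 The whole string-field law in the product metric on the `m⁻¹` road -/

/-- **★★ THE WHOLE STRING-FIELD LAW IN THE PRODUCT METRIC, `m⁻¹` ROAD** [folklore + bookkeeping].  Torus scheme with `β_K ≥ 0`, measurable `|obs| ≤ 1`,
countably many labels; uniform `Target` (`0 < l₀` — HYPOTHESIS); `Λ` a probability law on `ℝ^{List O}` carried by the cube receiving the limits of all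
continuous functionals of the string field; `e : ℕ → List O` any sequence of strings; `F` continuous with `|F x − F y| ≤ K_F·Σ_j 2^{−(j+1)}|x_{e_j} − y_{e_j}|`
and `|F| ≤ G_F` on the cube.  Then for every truncation level `M`, every Jackson parameter `m ≥ 1` and every step `K`:
`|∫ F((∏os)_{os}) dgibbs_K − ∫ F dΛ| ≤ 2K_F·2^{−M} + 2K_F·πM∕m + G_F·(m·9^m)^M·R_K` (truncate to the first `M` coordinates — p572113 `abs_sub_truncate_le` —
and apply §1 to the cylinder functional, `K_F`-Lipschitz in `ℓ¹` by p572113 `abs_sub_cylinder_le`). -/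
theorem abs_integral_stringField_sub_le_of_uniformTarget_jackson [Countable O] {vol l₀ : ℝ} {δ : ℕ → ℝ} (hl₀ : 0 < l₀)
    (hT : ∀ os : List O, NE7.Target vol l₀ δ (schemeZ S os)) (Λ : Measure (List O → ℝ)) [IsProbabilityMeasure Λ]
    (hΛ1 : Λ (Set.pi Set.univ (fun _ : List O => Set.Icc (-1 : ℝ) 1))ᶜ = 0)
    (hΛ : ∀ F : (List O → ℝ) → ℝ, Continuous F →
      Tendsto (fun K => ∫ U, F (fun os => prodObs S K os U) ∂gibbsMeasure (S.P K) (S.β K)) atTop (𝓝 (∫ x, F x ∂Λ)))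
    (e : ℕ → List O) {F : (List O → ℝ) → ℝ} (hFc : Continuous F) {KF GF : ℝ} (hK0 : 0 ≤ KF)
    (hF : ∀ x y : List O → ℝ, (∀ os, x os ∈ Set.Icc (-1 : ℝ) 1) → (∀ os, y os ∈ Set.Icc (-1 : ℝ) 1) →
      |F x - F y| ≤ KF * ∑' j, (1 / 2 : ℝ) ^ (j + 1) * |x (e j) - y (e j)|)
    (hG : ∀ x : List O → ℝ, (∀ os, x os ∈ Set.Icc (-1 : ℝ) 1) → |F x| ≤ GF) (M : ℕ) {m : ℕ} (hm0 : 0 < m) (K : ℕ) :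
    |∫ U, F (fun os => prodObs S K os U) ∂gibbsMeasure (S.P K) (S.β K) - ∫ x, F x ∂Λ| ≤
      2 * KF * (1 / 2 : ℝ) ^ M + 2 * KF * (π * M / m) + GF * (m * 9 ^ m) ^ M *
        (4 * Real.exp (1 + l₀) / l₀ * (∑' j, 2 * (vol * δ (K + j))) * (1 + Real.posLog (∑' j, 2 * (vol * δ (K + j)))⁻¹)) := by
  classical
  haveI hP : IsProbabilityMeasure (gibbsMeasure (G := G) (S.P K) (S.β K)) := T4GenFunBounds.isProbabilityMeasure_gibbsMeasure (G := G) (S.P K) (hβ K)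
  set J : Finset (List O) := (Finset.range M).image e with hJ
  -- the truncation and the cylinder functional
  set T : (List O → ℝ) → (List O → ℝ) := fun x os => if os ∈ J then x os else 0 with hTdef
  set f : (↥J → ℝ) → ℝ := fun u => F (fun os => if h : os ∈ J then u ⟨os, h⟩ else 0) with hfdef
  have hTf : ∀ x : List O → ℝ, F (T x) = f (fun i : ↥J => x i.1) := fun x => by
    simp only [hfdef, hTdef, dite_eq_ite]
  have hext : Continuous fun u : ↥J → ℝ => fun os : List O => if h : os ∈ J then u ⟨os, h⟩ else (0 : ℝ) :=
    continuous_pi fun os => by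
      by_cases h : os ∈ J
      · simp only [dif_pos h]; exact continuous_apply _
      · simp only [dif_neg h]; exact continuous_const
  have hfc : Continuous f := hFc.comp hext
  have hTc : Continuous T := continuous_pi fun os => by
    by_cases h : os ∈ J
    · simp only [hTdef, if_pos h]; exact continuous_apply os
    · simp only [hTdef, if_neg h]; exact continuous_const
  -- the cylinder functional is `K`-Lipschitz (ℓ¹) and `G`-bounded on the cube
  have hfK : ∀ u v : ↥J → ℝ, (∀ i, u i ∈ Set.Icc (-1 : ℝ) 1) → (∀ i, v i ∈ Set.Icc (-1 : ℝ) 1) → |f u - f v| ≤ KF * ∑ i, |u i - v i| :=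
    fun u v hu hv => abs_sub_cylinder_le e hK0 hF J u v hu hv
  have hfG : ∀ u : ↥J → ℝ, (∀ i, u i ∈ Set.Icc (-1 : ℝ) 1) → |f u| ≤ GF := fun u hu => hG _ fun os => by
    by_cases h : os ∈ J
    · simp only [dif_pos h]; exact hu _
    · simp only [dif_neg h]; norm_num
  -- §1 on the cylinder functional (`|J| ≤ M`)
  have hcyl := abs_integral_cylinder_sub_le_of_uniformTarget_jackson S hβ hm h1 hl₀ hT (fun i : ↥J => i.1) Λ hΛ1 hΛ hfc hK0 hfK hfG hm0 K
  have hcardN : Fintype.card ↥J ≤ M := by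
    rw [Fintype.card_coe]; exact Finset.card_image_le.trans (Finset.card_range M).le
  have hcard : (Fintype.card ↥J : ℝ) ≤ M := by exact_mod_cast hcardN
  have hR0 : 0 ≤ 4 * Real.exp (1 + l₀) / l₀ * (∑' j, 2 * (vol * δ (K + j))) * (1 + Real.posLog (∑' j, 2 * (vol * δ (K + j)))⁻¹) :=
    mul_nonneg (mul_nonneg (div_nonneg (mul_nonneg (by norm_num) (Real.exp_pos _).le) hl₀.le)
      (tsum_nonneg fun j => mul_nonneg two_pos.le (mul_nonneg_of_matchingModConstants hl₀.le (hT []).1 (K + j))))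
      (add_nonneg zero_le_one Real.posLog_nonneg)
  have hGF0 : 0 ≤ GF := (abs_nonneg _).trans (hG (fun _ => 0) fun _ => by norm_num)
  have hbase : (1 : ℝ) ≤ m * 9 ^ m := by
    have h9 : (1 : ℝ) ≤ 9 ^ m := one_le_pow₀ (by norm_num)
    have hm1 : (1 : ℝ) ≤ m := by exact_mod_cast hm0
    nlinarith
  have hcyl' : |∫ U, f (fun i : ↥J => prodObs S K i.1 U) ∂gibbsMeasure (S.P K) (S.β K) - ∫ x, f (fun i : ↥J => x i.1) ∂Λ| ≤
      2 * KF * (π * M / m) + GF * (m * 9 ^ m) ^ M *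
        (4 * Real.exp (1 + l₀) / l₀ * (∑' j, 2 * (vol * δ (K + j))) * (1 + Real.posLog (∑' j, 2 * (vol * δ (K + j)))⁻¹)) := by
    refine hcyl.trans (add_le_add ?_ ?_)
    · refine mul_le_mul_of_nonneg_left ?_ (by positivity)
      exact div_le_div_of_nonneg_right (mul_le_mul_of_nonneg_left hcard Real.pi_pos.le) (Nat.cast_nonneg _)
    · exact mul_le_mul_of_nonneg_right (mul_le_mul_of_nonneg_left (pow_le_pow_right₀ hbase hcardN) hGF0) hR0
  -- truncation errors under both laws
  have hX1 : ∀ U : GaugeField (S.P K) 0 G, ∀ os, prodObs S K os U ∈ Set.Icc (-1 : ℝ) 1 := fun U os =>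
    abs_le.1 (T4GenFunBounds.abs_prodObs_le_one S h1 K os U)
  have hmeasX : AEMeasurable (fun U : GaugeField (S.P K) 0 G => fun os => prodObs S K os U) (gibbsMeasure (S.P K) (S.β K)) :=
    (measurable_pi_lambda _ fun os => T4GenFunBounds.measurable_prodObs S hm K os).aemeasurable
  have hbdd : ∀ {Φ : (List O → ℝ) → ℝ}, Continuous Φ → ∃ C, ∀ x : List O → ℝ, (∀ os, x os ∈ Set.Icc (-1 : ℝ) 1) → |Φ x| ≤ C := by
    intro Φ hΦ
    obtain ⟨C, hC⟩ := (isCompact_univ_pi fun _ : List O => (isCompact_Icc : IsCompact (Set.Icc (-1 : ℝ) 1))).exists_bound_of_continuousOn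
      hΦ.continuousOn
    exact ⟨C, fun x hx => by simpa [Real.norm_eq_abs] using hC x (Set.mem_univ_pi.2 hx)⟩
  have hintX : ∀ {Φ : (List O → ℝ) → ℝ}, Continuous Φ → Integrable (fun U => Φ (fun os => prodObs S K os U)) (gibbsMeasure (S.P K) (S.β K)) := by
    intro Φ hΦ
    obtain ⟨C, hC⟩ := hbdd hΦ
    exact (integrable_const C).mono' (hΦ.comp_aestronglyMeasurable hmeasX.aestronglyMeasurable)
      (ae_of_all _ fun U => by rw [Real.norm_eq_abs]; exact hC _ (hX1 U))
  have hΛcube : ∀ᵐ x ∂Λ, x ∈ Set.pi Set.univ (fun _ : List O => Set.Icc (-1 : ℝ) 1) := mem_ae_iff.2 hΛ1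
  have hΛae : ∀ᵐ x ∂Λ, ∀ os, x os ∈ Set.Icc (-1 : ℝ) 1 := hΛcube.mono fun x hx os => Set.mem_univ_pi.1 hx os
  have hintΛ : ∀ {Φ : (List O → ℝ) → ℝ}, Continuous Φ → Integrable Φ Λ := by
    intro Φ hΦ
    obtain ⟨C, hC⟩ := hbdd hΦ
    exact (integrable_const C).mono' hΦ.aestronglyMeasurable (hΛae.mono fun x hx => by rw [Real.norm_eq_abs]; exact hC x hx)
  have herrX : |∫ U, F (fun os => prodObs S K os U) ∂gibbsMeasure (S.P K) (S.β K) -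
      ∫ U, F (T (fun os => prodObs S K os U)) ∂gibbsMeasure (S.P K) (S.β K)| ≤ KF * (1 / 2 : ℝ) ^ M := by
    rw [← integral_sub (hintX hFc) (hintX (Φ := fun x => F (T x)) (hFc.comp hTc)), ← Real.norm_eq_abs]
    refine (norm_integral_le_of_norm_le_const (Filter.Eventually.of_forall fun U => ?_)).trans (by rw [probReal_univ, mul_one])
    rw [Real.norm_eq_abs]
    exact abs_sub_truncate_le e hK0 hF M _ (hX1 U)
  have herrΛ : |∫ x, F x ∂Λ - ∫ x, F (T x) ∂Λ| ≤ KF * (1 / 2 : ℝ) ^ M := by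
    rw [← integral_sub (hintΛ hFc) (hintΛ (Φ := fun x => F (T x)) (hFc.comp hTc)), ← Real.norm_eq_abs]
    refine (norm_integral_le_of_norm_le_const (hΛae.mono fun x hx => ?_)).trans (by rw [probReal_univ, mul_one])
    rw [Real.norm_eq_abs]
    exact abs_sub_truncate_le e hK0 hF M x hx
  -- assemble
  have hmid : |∫ U, F (T (fun os => prodObs S K os U)) ∂gibbsMeasure (S.P K) (S.β K) - ∫ x, F (T x) ∂Λ| ≤
      2 * KF * (π * M / m) + GF * (m * 9 ^ m) ^ M *
        (4 * Real.exp (1 + l₀) / l₀ * (∑' j, 2 * (vol * δ (K + j))) * (1 + Real.posLog (∑' j, 2 * (vol * δ (K + j)))⁻¹)) := by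
    simpa only [hTf] using hcyl'
  rw [abs_sub_comm] at herrΛ
  calc |∫ U, F (fun os => prodObs S K os U) ∂gibbsMeasure (S.P K) (S.β K) - ∫ x, F x ∂Λ|
      = |(∫ U, F (fun os => prodObs S K os U) ∂gibbsMeasure (S.P K) (S.β K) - ∫ U, F (T (fun os => prodObs S K os U)) ∂gibbsMeasure (S.P K) (S.β K))
          + (∫ U, F (T (fun os => prodObs S K os U)) ∂gibbsMeasure (S.P K) (S.β K) - ∫ x, F (T x) ∂Λ)
          + (∫ x, F (T x) ∂Λ - ∫ x, F x ∂Λ)| := by ring_nf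
    _ ≤ KF * (1 / 2 : ℝ) ^ M + (2 * KF * (π * M / m) + GF * (m * 9 ^ m) ^ M *
          (4 * Real.exp (1 + l₀) / l₀ * (∑' j, 2 * (vol * δ (K + j))) * (1 + Real.posLog (∑' j, 2 * (vol * δ (K + j)))⁻¹)))
          + KF * (1 / 2 : ℝ) ^ M := (abs_add_three _ _ _).trans (add_le_add (add_le_add herrX hmid) herrΛ)
    _ = _ := by ring

/-! ## §3 One string, closed form: the marginal continuum law at `48(K+G)∕(1 + log R_K⁻¹)` — no `log K` -/

/-- **ONE RATE FOR EVERY MOMENT OF ONE STRING OBSERVABLE** [bookkeeping]: under uniform `Target` (`0 < l₀`), if `ν` receives the limits of all continuous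
observables of `∏os`, then for every `k` and every `K`: `|∫ (∏os)^k dgibbs_K − ∫ x^k dν| ≤ (4e^{1+l₀}∕l₀)·τ_K·(1 + log⁺ τ_K⁻¹)` — the `k`-th power is the
observable of the `k`-fold concatenated string (p558060 `prodObs_replicate_flatten`), p482030's rate does not see the string, limits are unique. -/
theorem abs_moment_sub_integral_le_of_uniformTarget {vol l₀ : ℝ} {δ : ℕ → ℝ} (hl₀ : 0 < l₀)
    (hT : ∀ os : List O, NE7.Target vol l₀ δ (schemeZ S os)) (os : List O) (ν : Measure ℝ)
    (hν : ∀ f : ℝ → ℝ, Continuous f →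
      Tendsto (fun K => ∫ U, f (prodObs S K os U) ∂gibbsMeasure (S.P K) (S.β K)) atTop (𝓝 (∫ x, f x ∂ν))) (k K : ℕ) :
    |∫ U, prodObs S K os U ^ k ∂gibbsMeasure (S.P K) (S.β K) - ∫ x, x ^ k ∂ν| ≤
      4 * Real.exp (1 + l₀) / l₀ * (∑' j, 2 * (vol * δ (K + j))) * (1 + Real.posLog (∑' j, 2 * (vol * δ (K + j)))⁻¹) := by
  set osk : List O := (List.replicate k os).flatten with hosk
  have hE : ∀ K, ∫ U, prodObs S K os U ^ k ∂gibbsMeasure (S.P K) (S.β K) = S.expectAt K osk := fun K => by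
    rw [expectAt_eq_integral_gibbs S hβ K]
    exact integral_congr_ae (ae_of_all _ fun U => (prodObs_replicate_flatten S K os k U).symm)
  obtain ⟨E, hEt, hrate⟩ := abs_expectAt_sub_lim_le_linlog_tail_of_target S hβ hm h1 hl₀ osk (hT osk)
  have hlim : Tendsto (fun K => S.expectAt K osk) atTop (𝓝 (∫ x, x ^ k ∂ν)) :=
    (hν _ (continuous_pow k)).congr fun K => hE K
  rw [hE, ← tendsto_nhds_unique hEt hlim]
  exact hrate K

/-- **★★ ONE STRING, CLOSED FORM: `|∫ g(∏os) dgibbs_K − ∫ g dν| ≤ 48(K_g + G_g)∕(1 + log R_K⁻¹)`** [folklore + bookkeeping].  Torus scheme with `β_K ≥ 0`,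
measurable `|obs| ≤ 1`; uniform `Target` (`0 < l₀` — HYPOTHESIS); `ν` a probability law on `[−1,1]` receiving the limits of all continuous observables of ONE
string `∏os` (g9's continuum law, p505344); `g` continuous, `K_g`-Lipschitz and `G_g`-bounded on `[−1,1]`; a step `K` with `0 < R_K ≤ 1`,
`R_K = (4e^{1+l₀}∕l₀)·τ_K·(1 + log⁺ τ_K⁻¹)`.  Then `|∫ g(∏os) dgibbs_K − ∫ g dν| ≤ 48(K_g + G_g)∕(1 + log R_K⁻¹)` (module 63 `law_price_le_of_uniformMoments`
at the uniform moment rate above) — `≍ 1∕K` for geometric remainders: the `log K` of p556871's `log K∕K` was the price of using ONE string's window only. -/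
theorem abs_integral_sub_continuumLaw_le_inv_log_of_uniformTarget {vol l₀ : ℝ} {δ : ℕ → ℝ} (hl₀ : 0 < l₀)
    (hT : ∀ os : List O, NE7.Target vol l₀ δ (schemeZ S os)) (os : List O) (ν : Measure ℝ) [IsProbabilityMeasure ν]
    (hν1 : ν (Set.Icc (-1 : ℝ) 1)ᶜ = 0)
    (hν : ∀ f : ℝ → ℝ, Continuous f →
      Tendsto (fun K => ∫ U, f (prodObs S K os U) ∂gibbsMeasure (S.P K) (S.β K)) atTop (𝓝 (∫ x, f x ∂ν)))
    {g : ℝ → ℝ} (hg : Continuous g) {Kg Gg : ℝ} (hK0 : 0 ≤ Kg)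
    (hK : ∀ x y : ℝ, x ∈ Set.Icc (-1 : ℝ) 1 → y ∈ Set.Icc (-1 : ℝ) 1 → |g x - g y| ≤ Kg * |x - y|)
    (hG : ∀ x : ℝ, x ∈ Set.Icc (-1 : ℝ) 1 → |g x| ≤ Gg) (K : ℕ)
    (hR0 : 0 < 4 * Real.exp (1 + l₀) / l₀ * (∑' j, 2 * (vol * δ (K + j))) * (1 + Real.posLog (∑' j, 2 * (vol * δ (K + j)))⁻¹))
    (hR1 : 4 * Real.exp (1 + l₀) / l₀ * (∑' j, 2 * (vol * δ (K + j))) * (1 + Real.posLog (∑' j, 2 * (vol * δ (K + j)))⁻¹) ≤ 1) :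
    |∫ U, g (prodObs S K os U) ∂gibbsMeasure (S.P K) (S.β K) - ∫ x, g x ∂ν| ≤
      48 * (Kg + Gg) / (1 + Real.log (4 * Real.exp (1 + l₀) / l₀ * (∑' j, 2 * (vol * δ (K + j))) *
        (1 + Real.posLog (∑' j, 2 * (vol * δ (K + j)))⁻¹))⁻¹) := by
  haveI hP : IsProbabilityMeasure (gibbsMeasure (G := G) (S.P K) (S.β K)) := T4GenFunBounds.isProbabilityMeasure_gibbsMeasure (G := G) (S.P K) (hβ K)
  have hmeas : Measurable (prodObs S K os) := T4GenFunBounds.measurable_prodObs S hm K os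
  set μ : Measure ℝ := (gibbsMeasure (S.P K) (S.β K)).map (prodObs S K os) with hμdef
  haveI : IsProbabilityMeasure μ := Measure.isProbabilityMeasure_map hmeas.aemeasurable
  have hμ1 : μ (Set.Icc (-1 : ℝ) 1)ᶜ = 0 := by
    rw [hμdef, Measure.map_apply hmeas measurableSet_Icc.compl]
    have he : prodObs S K os ⁻¹' (Set.Icc (-1 : ℝ) 1)ᶜ = ∅ := by
      ext U
      simp only [Set.mem_preimage, Set.mem_compl_iff, Set.mem_empty_iff_false, iff_false, not_not]
      exact abs_le.1 (T4GenFunBounds.abs_prodObs_le_one S h1 K os U)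
    rw [he, measure_empty]
  have hint : ∀ {f : ℝ → ℝ}, Continuous f → ∫ x, f x ∂μ = ∫ U, f (prodObs S K os U) ∂gibbsMeasure (S.P K) (S.β K) :=
    fun hf => integral_map hmeas.aemeasurable hf.aestronglyMeasurable
  have hmom : ∀ k : ℕ, |∫ x, x ^ k ∂ν - ∫ x, x ^ k ∂μ| ≤
      4 * Real.exp (1 + l₀) / l₀ * (∑' j, 2 * (vol * δ (K + j))) * (1 + Real.posLog (∑' j, 2 * (vol * δ (K + j)))⁻¹) := fun k => by
    rw [hint (continuous_pow k), abs_sub_comm]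
    exact abs_moment_sub_integral_le_of_uniformTarget S hβ hm h1 hl₀ hT os ν hν k K
  have h := law_price_le_of_uniformMoments hμ1 hν1 hR0 hR1 hmom hg hK0 hK hG
  rwa [hint hg, abs_sub_comm] at h

end Summit.QuantumFields.YangMills.Theorems.BalabanUVNodesN19JointLawSharpRate

end
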